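import Summits.ValiantsHypothesis.ValiantsHypothesis.Theorems.DivisionGapPerDivisionHardStubSparseRigid

/-!
# Crux `DivisionGap.PerDivisionHard` (stmt-ValiantsHypothesis-5065), line `pair-descent-jss-endpoint` —
stub `stub_subexpRigid`: K2 for cofactors with `≤ 2^{n/(log₂ n+e)^e}` monomials

`stub_subexpRigid`: for all `d` there are `e n₀` such that for `n ≥ n₀` every nonzero
torus-homogeneous `h ∈ ℝ≥0[x_ij]` with at most `2^{n/(log₂ n + e)^e}` monomials admits a placement
`eR eC` of the block arsenal `G(b,k) ⊕ M₀` with `b ≥ (log₂ n + d)^d`, a weight `w` cutting out the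
placed face of the Birkhoff polytope, and a single `G`-part `u` of its top-`w` fibre.

This is `stub_sparseRigid` (`Theorems/DivisionGapPerDivisionHardStubSparseRigid.lean`) verbatim
with LONG subdivision paths.  Parameters: `L = log₂ n`, `q = (L + d + 1)^{d+1}`, `b = q`,
`k = n / (4q²)`, `N = q + q²k` corner rows, `t₀ = 4k + 2`, `e = 2d + 4` (so `(L + e)^e ≥ 4q²`,
whence `n / (L + e)^e ≤ k` and `|supp h|² ≤ 2^{2k} ≤ 2^{t₀}`), `n ≥ 16q³` (so `k ≥ 1` and
`2N + t₀ ≤ n`).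
1. Placement by counting (`exists_goodSubset`, `count_lt`): the ordered pairs of monomials of `h`
   differing in `≥ t₀` rows are at most `2^{t₀}`, so some `N`-set `R` of rows contains no such
   row set; label the rows so that the core and internal labels land in `R` (`exists_blockEquiv`).
2. The generic weight cuts out the placed graph `G` (`cutsOut_genericWeight`, via the perfect
   matching `exists_blockMatching`), and its top fibre agrees off `G`
   (`eq_offG_of_mem_support_topComponent`).
3. Two distinct monomials of the top fibre differ by an integer matrix supported on `G` with
   vanishing margins, which occupies `≥ 4k + 2 = t₀` rows (`placedFlow_card_rows`), all of them
   corner rows (`placedFlow_row_notPadding`) — excluded by step 1.  So the top fibre is a single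
   monomial `m₀`, and `u = m₀|_G`.
-/

noncomputable section

-- `Summit.ValiantsHypothesis.ValiantsHypothesis.…` is the tree's mandated single-conjunct layout
-- (Sub = Summit), so the duplicated namespace component is intended.
set_option linter.dupNamespace false

namespace Summit.ValiantsHypothesis.ValiantsHypothesis.Theorems.DivisionGapPerDivisionHard

open MvPolynomial Literature.Computability.AlgebraicComplexity
open Summit.ValiantsHypothesis.ValiantsHypothesis.Theorems.ZeroOneTransfer.Negative
open scoped NNReal

/-- The exponent bookkeeping of `stub_subexpRigid`: with `q = (L + d + 1)^{d+1}` and `e = 2d + 4`,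
`4q² ≤ (L + e)^e`. [folklore] -/
theorem four_mul_sq_le_pow (L d : ℕ) :
    4 * ((L + d + 1) ^ (d + 1) * (L + d + 1) ^ (d + 1)) ≤ (L + (2 * d + 4)) ^ (2 * d + 4) := by
  have h1 : (L + d + 1) ^ (d + 1) ≤ (L + (2 * d + 4)) ^ (d + 1) :=
    Nat.pow_le_pow_left (by omega) _
  have h2 : 4 ≤ (L + (2 * d + 4)) ^ 2 :=
    calc 4 ≤ L + (2 * d + 4) := by omega
      _ ≤ (L + (2 * d + 4)) ^ 2 := Nat.le_self_pow two_ne_zero _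
  calc 4 * ((L + d + 1) ^ (d + 1) * (L + d + 1) ^ (d + 1))
      ≤ (L + (2 * d + 4)) ^ 2 * ((L + (2 * d + 4)) ^ (d + 1) * (L + (2 * d + 4)) ^ (d + 1)) :=
        Nat.mul_le_mul h2 (Nat.mul_le_mul h1 h1)
    _ = (L + (2 * d + 4)) ^ (2 * d + 4) := by ring

/-- **`stub_subexpRigid` (K2 of line `pair-descent-jss-endpoint` for cofactors with
`≤ 2^{n/(log₂ n+e)^e}` monomials).**  For all `d` there are `e n₀` such that for `n ≥ n₀` every
nonzero torus-homogeneous `h ∈ ℝ≥0[x_ij]` with at most `2^{n/(log₂ n + e)^e}` monomials admits a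
placement `eR eC` of `G(b,k) ⊕ M₀` with `(log₂ n + d)^d ≤ b`, a weight `w` cutting out the placed
face, and a single `G`-part `u` of the top-`w` fibre of `h` (which is in fact a single monomial).
`stub_sparseRigid` with long subdivision paths `k = n / (4q²)`, `b = q = (log₂ n + d + 1)^{d+1}`,
`e = 2d + 4`: placement by counting over the `≤ 2^{4k+2}` ordered pairs of monomials, generic
weight, girth substitute `4k + 2`. [folklore] -/
theorem stub_subexpRigid :
    ∀ d : ℕ, ∃ e n₀ : ℕ, ∀ n ≥ n₀, ∀ h : MvPolynomial (Fin n × Fin n) ℝ≥0,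
      h ≠ 0 → IsTorusHomogeneous h → h.support.card ≤ 2 ^ (n / (Nat.log 2 n + e) ^ e) →
      ∃ (b k m : ℕ) (eR eC : BlockV b k m ≃ Fin n) (w : Fin n × Fin n → ℕ)
        (u : (Fin n × Fin n) →₀ ℕ),
        (Nat.log 2 n + d) ^ d ≤ b ∧ CutsOut w (placedBlock eR eC) ∧
          HasSingleGPart (placedBlock eR eC) w h u := by
  intro d
  obtain ⟨L₀, hL₀⟩ := growth d
  refine ⟨2 * d + 4, 2 ^ (L₀ + 1), fun n hn h hh htor hcard => ?_⟩
  -- the parameters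
  have hn0 : n ≠ 0 := by
    have : 1 ≤ 2 ^ (L₀ + 1) := Nat.one_le_two_pow
    omega
  have hLL₀ : L₀ + 1 ≤ Nat.log 2 n := Nat.le_log_of_pow_le one_lt_two hn
  have h2L : 2 ^ Nat.log 2 n ≤ n := Nat.pow_log_le_self 2 hn0
  have hq16 := hL₀ (Nat.log 2 n) (by omega)
  have he := four_mul_sq_le_pow (Nat.log 2 n) d
  set L := Nat.log 2 n with hL
  have hy : 2 ≤ L + d + 1 := by omega
  have hdq : (L + d) ^ d ≤ (L + d + 1) ^ (d + 1) :=
    (Nat.pow_le_pow_left (by omega) d).trans (Nat.pow_le_pow_right (by omega) (by omega))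
  have hq2 : 2 ≤ (L + d + 1) ^ (d + 1) :=
    (Nat.le_self_pow (Nat.succ_ne_zero _) 2).trans (Nat.pow_le_pow_left hy _)
  set q := (L + d + 1) ^ (d + 1) with hq
  have hQ : 4 * q ≤ q * (q * q) := Nat.mul_comm 4 q ▸ Nat.mul_le_mul_left q (Nat.mul_le_mul hq2 hq2)
  have hqq : 4 ≤ q * q := Nat.mul_le_mul hq2 hq2
  have hq0 : 0 < q := by omega
  have hqqq : q * q ≤ q * (q * q) := Nat.mul_le_mul_left q (Nat.le_mul_of_pos_left q hq0)
  -- the subdivision length `k = n / (4q²)`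
  have h4qq : 0 < 4 * (q * q) := by omega
  have hk : 0 < n / (4 * (q * q)) := Nat.div_pos (by omega) h4qq
  have hX : 4 * (q * (q * (n / (4 * (q * q))))) ≤ n :=
    calc 4 * (q * (q * (n / (4 * (q * q))))) = n / (4 * (q * q)) * (4 * (q * q)) := by ring
      _ ≤ n := Nat.div_mul_le_self n (4 * (q * q))
  have hke : n / (L + (2 * d + 4)) ^ (2 * d + 4) ≤ n / (4 * (q * q)) :=
    Nat.div_le_div_left he h4qq
  set k := n / (4 * (q * q)) with hkdef
  have h4k : 4 * k ≤ q * (q * k) := by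
    rw [← Nat.mul_assoc]
    exact Nat.mul_le_mul_right k hqq
  -- bad pairs of monomials: those differing in at least `4k + 2` rows
  let T : ((Fin n × Fin n) →₀ ℕ) × ((Fin n × Fin n) →₀ ℕ) → Finset (Fin n) := fun p =>
    Finset.univ.filter fun r => ∃ col, p.1 (r, col) ≠ p.2 (r, col)
  set P := (h.support ×ˢ h.support).filter fun p => 4 * k + 2 ≤ (T p).card with hP
  have hPcard : P.card ≤ 2 ^ (4 * k + 2) :=
    calc P.card ≤ (h.support ×ˢ h.support).card := Finset.card_filter_le _ _
      _ = h.support.card * h.support.card := Finset.card_product _ _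
      _ ≤ 2 ^ (n / (L + (2 * d + 4)) ^ (2 * d + 4)) * 2 ^ (n / (L + (2 * d + 4)) ^ (2 * d + 4)) :=
          Nat.mul_le_mul hcard hcard
      _ = 2 ^ (2 * (n / (L + (2 * d + 4)) ^ (2 * d + 4))) := by rw [← pow_add, ← two_mul]
      _ ≤ 2 ^ (4 * k + 2) := Nat.pow_le_pow_right two_pos (by omega)
  -- a good set of `N = q + q²k` corner rows and the placement
  obtain ⟨R, hRcard, hRgood⟩ := exists_goodSubset P T (q + q * (q * k)) (4 * k + 2)
    (fun p hp => (Finset.mem_filter.mp hp).2)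
    (by rw [Fintype.card_fin]; exact count_lt (by omega) (by omega) hPcard (by omega))
  obtain ⟨eR, heR₁, heR₂⟩ :=
    exists_blockEquiv R q k (n - (q + q * (q * k))) hRcard (by rw [hRcard])
  set G := placedBlock eR eR with hG
  set B := h.totalDegree + 1 with hB
  -- the generic weight cuts out `G`
  obtain ⟨g, hg⟩ := exists_blockMatching q k (n - (q + q * (q * k))) hk
  obtain ⟨σ₀, hσ₀⟩ := exists_perm_mem_placedBlock eR eR g hg
  have hcut : CutsOut (genericWeight G B) G := cutsOut_genericWeight G (Nat.succ_pos _) σ₀ hσ₀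
  -- the top fibre is a single monomial
  have hfib : ∀ m₁ ∈ (topComponent (genericWeight G B) h).support,
      ∀ m₂ ∈ (topComponent (genericWeight G B) h).support, m₁ = m₂ := by
    intro m₁ hm₁ m₂ hm₂
    have hs₁ := support_topComponent_subset _ h hm₁
    have hs₂ := support_topComponent_subset _ h hm₂
    obtain ⟨r₀, c₀, hrc⟩ := htor
    have hoff := eq_offG_of_mem_support_topComponent G hm₁ hm₂
      (degree_eq_of_rowDegrees_eq ((hrc m₁ hs₁).1.trans (hrc m₂ hs₂).1.symm))
    by_contra hne
    -- the difference `D = m₁ - m₂`: supported on `G`, vanishing margins, nonzero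
    obtain ⟨hrow, hcol⟩ := sum_diff_eq_zero ((hrc m₁ hs₁).1.trans (hrc m₂ hs₂).1.symm)
      ((hrc m₁ hs₁).2.trans (hrc m₂ hs₂).2.symm)
    have hDG : ∀ e, (fun e => (m₁ e : ℤ) - m₂ e) e ≠ 0 → e ∈ G := fun e he => by
      by_contra heG
      exact he (by simp only [hoff e heG, sub_self])
    have hDne : ∃ e, (fun e => (m₁ e : ℤ) - m₂ e) e ≠ 0 := by
      by_contra hall
      push Not at hall
      exact hne (Finsupp.ext fun e => by exact_mod_cast sub_eq_zero.mp (hall e))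
    have hrows := placedFlow_card_rows eR eR hk hDG hrow hcol hDne
    have hTD : T (m₁, m₂) = Finset.univ.filter fun r => ∃ c', (m₁ (r, c') : ℤ) - m₂ (r, c') ≠ 0 := by
      simp only [T, ne_eq, sub_eq_zero, Nat.cast_inj]
    -- so `(m₁, m₂)` is a bad pair whose rows lie in `R`: excluded by the choice of `R`
    have hmem : (m₁, m₂) ∈ P :=
      Finset.mem_filter.mpr ⟨Finset.mk_mem_product hs₁ hs₂, by rw [hTD]; exact hrows⟩
    refine hRgood _ hmem fun r hr => ?_
    rw [hTD] at hr
    obtain ⟨c', hc'⟩ := (Finset.mem_filter.mp hr).2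
    have hpad := placedFlow_row_notPadding eR eR hDG hrow hcol hc'
    obtain ⟨x, rfl⟩ := eR.surjective r
    rcases x with i | p | u
    · exact heR₁ i
    · exact heR₂ p
    · exact absurd (eR.symm_apply_apply _) (hpad u)
  -- conclusion: `u` is the `G`-part of the unique monomial of the top fibre
  obtain ⟨m₀, hm₀⟩ := support_nonempty.mpr (topComponent_ne_zero (genericWeight G B) hh)
  refine ⟨q, k, n - (q + q * (q * k)), eR, eR, genericWeight G B, m₀.filter (· ∈ G), hdq, hcut,
    fun e he => ?_, fun m' hm' e he => ?_⟩
  · rw [Finsupp.support_filter] at he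
    exact (Finset.mem_filter.mp he).2
  · rw [hfib m' hm' m₀ hm₀, Finsupp.filter_apply_pos _ _ he]

end Summit.ValiantsHypothesis.ValiantsHypothesis.Theorems.DivisionGapPerDivisionHard

end
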